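import Mathlib
import Literature.NumberTheory.Automorphic.BrandtXi
import Literature.NumberTheory.EllipticCurves.Szpiro
import Summits.ABC.ABC.Theses.DefiniteXi

/-!
Sketch for crux-ideate stmt-ABC-11337 (XiStrongBound), ideator 2, round 1.
First lemmas of the two idea cards; statements only (elaboration check), proofs `sorry`.
-/

open scoped Matrix
open Polynomial

namespace Summit.ABC.ABC.Cruxes.XiStrongBound.Sketch

/-! ### Card `frey-kirchhoff-smith-defect` -/

/-- FIRST LEMMA (K1, "Kirchhoff for a simple eigenline", pure matrix algebra over `ℤ`).
`A` an integer matrix, `a` an integer, `φ` a right and `ψ` a left eigenvector for `a`, both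
primitive, and `rank (A - a) = card - 1` (the eigenvalue is simple).  Then the adjugate of `A - a`
is an integer multiple `c` of the rank-one matrix `φ ψᵀ`, `|c|` is the gcd of the maximal minors
(= order of the torsion of `coker (A - a)`), and `c ⟪ψ, φ⟫ = ± χ_A'(a)`.  For the Brandt matrix
`A = B(p)`, `ψ = (w_i φ_i)/g`, this reads `ξ' · #K_a(B(p)) = |∏_{g ≠ f} (a_p(g) - a_p(f))|`. -/
theorem adjugate_sub_scalar_of_simple
    {ι : Type*} [Fintype ι] [DecidableEq ι] (A : Matrix ι ι ℤ) (a : ℤ) (φ ψ : ι → ℤ)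
    (hφ : A *ᵥ φ = a • φ) (hψ : ψ ᵥ* A = a • ψ)
    (hφprim : ∀ d : ℤ, (∀ i, d ∣ φ i) → IsUnit d) (hψprim : ∀ d : ℤ, (∀ i, d ∣ ψ i) → IsUnit d)
    (hrank : (A - Matrix.scalar ι a).rank + 1 = Fintype.card ι) :
    ∃ c : ℤ, (A - Matrix.scalar ι a).adjugate = c • Matrix.vecMulVec φ ψ ∧
      (c * (ψ ⬝ᵥ φ)).natAbs = ((Polynomial.derivative A.charpoly).eval a).natAbs := by
  sorry

/-- FIRST LEMMA, Brandt form (K1'): for every Brandt setup `S` of level `(N⁺, N⁻)`, every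
eigenvalue system `λ` and every prime `p ∤ N⁺ N⁻`, the definite congruence number `ξ = S.xi λ`
DIVIDES `(∏_i w_i) · χ'_{B(p)}(λ p)` — no simplicity hypothesis needed (if `λ p` is a multiple
eigenvalue the right-hand side is `0`; `hline` excludes the junk case of an empty eigen-lattice,
where `ξ = 0` but `χ'` need not vanish).  Hypothesis `hsym` is Gross/Voight's `w_i T_ij = w_j T_ji`
(Voight §41.1), not yet a tree fact. -/
theorem xi_dvd_prod_weight_mul_derivative_charpoly
    {Np Nm : ℕ} (S : Literature.NumberTheory.Automorphic.Brandt.XiSetup Np Nm)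
    [Fintype (Literature.NumberTheory.Automorphic.Brandt.ClassSet S.O)]
    [DecidableEq (Literature.NumberTheory.Automorphic.Brandt.ClassSet S.O)]
    (hsym : ∀ n i j, (Literature.NumberTheory.Automorphic.Brandt.weight S.O i : ℤ) *
        Literature.NumberTheory.Automorphic.Brandt.matrix S.O n i j =
      (Literature.NumberTheory.Automorphic.Brandt.weight S.O j : ℤ) *
        Literature.NumberTheory.Automorphic.Brandt.matrix S.O n j i)
    (lam : ℕ → ℤ)
    (hline : ∃ v : Literature.NumberTheory.Automorphic.Brandt.ClassSet S.O → ℤ, v ≠ 0 ∧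
      v ∈ Literature.NumberTheory.Automorphic.Brandt.eigenLattice (Np * Nm)
        (Literature.NumberTheory.Automorphic.Brandt.matrix S.O) lam)
    (p : ℕ) (hp : p.Prime) (hpN : ¬ p ∣ Np * Nm) :
    (S.xi lam : ℤ) ∣ (∏ i, (Literature.NumberTheory.Automorphic.Brandt.weight S.O i : ℤ)) *
      (Polynomial.derivative (Literature.NumberTheory.Automorphic.Brandt.matrix S.O p).charpoly).eval
        (lam p) := by
  sorry

/-- PINNING LEMMA (K1''): a Frey curve with `3 ∤ a b (a + b)` reduces mod `3` to `y² = x³ - x`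
(supersingular), so its third L-series coefficient vanishes: at the least good prime the Frey
eigenvalue is pinned, and K1' is a statement about `χ'_{B(3)}(0)`, i.e. about the product of the
non-zero eigenvalues of the 4-regular Pizer graph versus its Smith group. -/
theorem frey_a3_eq_zero (a b : ℤ) (hab : IsCoprime a b) (h3 : ¬ (3 : ℤ) ∣ a * b * (a + b)) :
    (Literature.NumberTheory.EllipticCurves.freyCurve a b).LFunction 3 = 0 := by
  sorry

/-! ### Card `reducible-cluster-class-group` -/

/-- FIRST LEMMA (R1): the Frey newform is Eisenstein modulo `4` away from `2ab(a+b)`: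
full rational `2`-torsion `{O, (0,0), (a,0), (-b,0)}` injects into `E(𝔽_p)`, so `4 ∣ #E(𝔽_p)`
and `a_p ≡ p + 1 (mod 4)` at every odd prime of good reduction of the model `freyCurve a b`. -/
theorem frey_ap_modEq_four (a b : ℤ) (hab : IsCoprime a b) (p : ℕ) (hp : p.Prime) (hp2 : p ≠ 2)
    (hgood : ¬ (p : ℤ) ∣ a * b * (a + b)) :
    (Literature.NumberTheory.EllipticCurves.freyCurve a b).LFunction p ≡ p + 1 [ZMOD 4] := by
  sorry

/-- The factor split used by card `reducible-cluster-class-group` (its partial `Transfer`): the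
`ℓ`-primary part of the crux quantity `ξ(E; N/Nm, Nm) · ∏_{q ∣ Nm} v_q(Δ_min)` is polynomially
bounded with exponent `κ`.  The card's sub-crux is `XiPrimaryPartBound 2 κ` (the residually
reducible prime of every Frey curve); `XiStrongBound` needs in addition the prime-to-`2` part, with
exponents adding up to `2 + ε` — the split of the exponent is not known, which the card states. -/
def XiPrimaryPartBound (ℓ : ℕ) (κ : ℝ) : Prop :=
  ∃ C : ℝ, ∀ a b : ℤ, IsCoprime a b → a * b * (a + b) ≠ 0 → ∀ (N : ℕ) [NeZero N],
    (Literature.NumberTheory.EllipticCurves.freyCurve a b).conductorNorm ℤ = N →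
    ∀ Nm : ℕ, Odd Nm → Squarefree Nm → Odd Nm.primeFactors.card → Nm ∣ N →
      ((ℓ : ℝ) ^ (padicValNat ℓ
          (Literature.NumberTheory.Automorphic.brandtXi (N / Nm) Nm
              (fun n => (Literature.NumberTheory.EllipticCurves.freyCurve a b).LFunction n) *
            ∏ q ∈ Nm.primeFactors,
              ((Literature.NumberTheory.EllipticCurves.freyCurve a b).minimalDiscriminantNorm ℤ).factorization q)))
        ≤ C * (N : ℝ) ^ κ

/-- Sanity statement of the split (R2, provable bookkeeping once stated with all primes): the crux
follows from primary-part bounds at every prime with summable exponents — recorded here only in the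
two-factor form actually proposed: `2`-part exponent `κ₂`, odd part exponent `κ'`, `κ₂ + κ' ≤ 2 + ε`. -/
def OddPartBound (κ : ℝ) : Prop :=
  ∃ C : ℝ, ∀ a b : ℤ, IsCoprime a b → a * b * (a + b) ≠ 0 → ∀ (N : ℕ) [NeZero N],
    (Literature.NumberTheory.EllipticCurves.freyCurve a b).conductorNorm ℤ = N →
    ∀ Nm : ℕ, Odd Nm → Squarefree Nm → Odd Nm.primeFactors.card → Nm ∣ N →
      (((Literature.NumberTheory.Automorphic.brandtXi (N / Nm) Nm
              (fun n => (Literature.NumberTheory.EllipticCurves.freyCurve a b).LFunction n) *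
            ∏ q ∈ Nm.primeFactors,
              ((Literature.NumberTheory.EllipticCurves.freyCurve a b).minimalDiscriminantNorm ℤ).factorization q) /
          2 ^ (padicValNat 2
            (Literature.NumberTheory.Automorphic.brandtXi (N / Nm) Nm
              (fun n => (Literature.NumberTheory.EllipticCurves.freyCurve a b).LFunction n) *
            ∏ q ∈ Nm.primeFactors,
              ((Literature.NumberTheory.EllipticCurves.freyCurve a b).minimalDiscriminantNorm ℤ).factorization q)) : ℕ) : ℝ)
        ≤ C * (N : ℝ) ^ κ

/-- R2 (bookkeeping, provable: multiply the two bounds; `x = 2^{v_2 x} · (x / 2^{v_2 x})` in `ℕ`):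
the two-factor split recovers the crux when the exponents add up. -/
theorem xiStrongBound_of_split
    (h : ∀ ε : ℝ, 0 < ε → ∃ κ₂ κ' : ℝ, κ₂ + κ' ≤ 2 + ε ∧ XiPrimaryPartBound 2 κ₂ ∧ OddPartBound κ') :
    Summit.ABC.ABC.Theses.DefiniteXi.XiStrongBound := by
  sorry

end Summit.ABC.ABC.Cruxes.XiStrongBound.Sketch
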